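import Literature.NumberTheory.Sieve.PolymathProductHoeffding
import HarnessLib

/-!
# The explicit Hoeffding-recentred lattice inequality for Polymath's product test functions

Topic `Literature/NumberTheory/Sieve`, namespace `Literature.NumberTheory.Sieve.MaynardTao` (sequel of
`PolymathProductTestFunctions`, `PolymathProductLatticeBounds`, `PolymathProductHoeffding`).  Everything here is
PROVED; standard axioms.

In the proof of [cite: Polymath8b2014, §6, Theorem 6.7] the Maynard functional of the product test function
`F = ∏ g(tᵢ)` on `R_k`, `g = 1_{[0,T]}/(c + (k−1)t)`, is the ratio `k J_k(F)/I(F)` with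
`I(F) = ∫_{(0,1]} (g²)^{⋆k}` and `J_k(F) = ∫_{(0,1]} (∫₀^{1−w} g)² (g²)^{⋆(k−1)}(w) dw` (`maynardFunctional_productTestFn`).
`PolymathProductHoeffding` discretises both convolution integrals on a lattice `hℕ` (cell masses
`p_j = ∫_{(jh,(j+1)h]} g²`, discrete convolution powers `p^{∗n}`) and recentres the accumulated rounding error by
Hoeffding's inequality [cite: Hoeffding1963, Thm 2].  This file packages the two one-sided bounds into the single
ratio inequality a kernel certificate has to check,

  `k · (N⁻ − G(T)² m₀^{k−1} e^{−2λ₂²/((k−1)h²)}) / (D⁺ + m₀^k e^{−2λ₁²/(k h²)}) ≤ M_k(F)`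

(`maynardFunctional_productTestFn_ge_hoeffdingRatio`, any admissible profile `g`), and then makes every real
number in it explicit for Polymath's profile (`maynardFunctional_polymathProfile_ge_hoeffdingRatio`): the mass
`m₀ = ∫ g² = T/(c(c+(k−1)T))` (`setIntegral_Ici_polymathProfile_sq`), the first moment
`∫ t g² = (log((c+(k−1)T)/c) − (k−1)T/(c+(k−1)T))/(k−1)²` (`setIntegral_Ici_id_mul_polymathProfile_sq`), and the
mean rounding error `∫ r_h g² = ∫ t g² − h Σ_j j p_j` (`setIntegral_roundErr_mul_eq`); the cell masses `p_j` are the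
rationals of `cellMass_polymathProfile_sq` and the weights `∫_{(0,x]} g = log((c+(k−1)min(x⁺,T))/c)/(k−1)`
(`setIntegral_Ioc_polymathProfile`, file `PolymathProductLatticeBounds`).  What remains for a certificate
`M_k > 4m` is interval arithmetic on finitely many logarithms / exponentials and one exact computation of the
lattice sums `D⁺`, `N⁻`.
-/

noncomputable section

open MeasureTheory Set Finset Real Literature.Analysis.Convolution ProbabilityTheory
open scoped BigOperators NNReal ENNReal

namespace Literature.NumberTheory.Sieve

namespace MaynardTao

/-! ### The Hoeffding-recentred ratio bound for product test functions -/

section HoeffdingRatio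

variable {g : ℝ → ℝ} {h T : ℝ} {Jc : ℕ}

/-- Squares of locally bounded functions are locally bounded. [folklore] -/
private theorem locBdd_sq'' (hg : LocBdd g) : LocBdd fun t => g t ^ 2 := by
  have : (fun t => g t ^ 2) = fun t => g t * g t := by funext t; ring
  rw [this]
  exact hg.mul hg

/-- The truncated primitive `y ↦ ∫_{(0,y]} g` of `g ≥ 0` vanishing beyond `T ≥ 0` is bounded by `∫_{(0,T]} g`.
[cite: Polymath8b2014, §6, proof of Theorem 6.7 (∫_{[0,r−S_{k−1}]} g(t) dt with g supported on [0,T])] -/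
theorem setIntegral_Ioc_le_setIntegral_Ioc_of_support (hg : LocBdd g) (hg0 : ∀ t, 0 ≤ g t)
    (hgT : ∀ x, T < x → g x = 0) (hT0 : 0 ≤ T) (y : ℝ) :
    ∫ u in Ioc 0 y, g u ≤ ∫ u in Ioc 0 T, g u := by
  by_cases hy : y ≤ T
  · exact setIntegral_mono_set (hg.integrableOn_Ioc _ _) (Filter.Eventually.of_forall fun u => hg0 u)
      (Filter.Eventually.of_forall (Ioc_subset_Ioc_right hy))
  · have hTy : T ≤ y := (not_le.1 hy).le
    rw [← intervalIntegral.integral_of_le (hT0.trans hTy), ← intervalIntegral.integral_of_le hT0,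
      ← intervalIntegral.integral_add_adjacent_intervals (b := T)
        (intervalIntegrable_iff.2 (hg.integrableOn_Ioc _ _))
        (intervalIntegrable_iff.2 (hg.integrableOn_Ioc _ _))]
    have h2 : ∫ u in T..y, g u = 0 := by
      rw [intervalIntegral.integral_of_le hTy]
      refine (setIntegral_congr_fun measurableSet_Ioc (g := fun _ => (0:ℝ)) fun t ht => ?_).trans (by simp)
      exact hgT t ht.1
    rw [h2, add_zero]

/-- **Hoeffding-recentred lattice lower bound for the functional of a product test function.**  For a locally bounded
profile `g ≥ 0` vanishing beyond `T ≥ 0`, `k = n + 2`, span `h > 0` with `T < J_c h`, mass `m₀ = ∫_{[0,∞)} g² > 0`, mean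
rounding error `e = (∫_{[0,∞)} r_h g²)/m₀`, parameters `m⋆, M, δ, λ₁, λ₂ ≥ 0` with `1 − (m⋆+1)h + λ₁ ≤ k e` and
`δ + λ₂ ≤ (k−1)(h − e)`:
`k · (N⁻ − G(T)² m₀^{k−1} e^{−2λ₂²/((k−1)h²)}) / (D⁺ + m₀^k e^{−2λ₁²/(k h²)}) ≤ (Σ J^{(m)}(F))/I(F)`,
`D⁺ = Σ_{m≤m⋆} (p^{∗k})_m`, `N⁻ = Σ_{m<M} (∫_{(0, 1−((m+k−1)h−δ)]} g)² (p^{∗(k−1)})_m`, `G(T) = ∫_{(0,T]} g`, `p_j = ∫_{(jh,(j+1)h]} g²`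
— the representation `k J_k(F)/I(F)` of the proof of Theorem 6.7 with both convolution integrals discretised on the lattice and
the rounding errors recentred by Hoeffding's inequality. [cite: Polymath8b2014, §6, proof of Theorem 6.7 (I(F), J_k(F))] -/
theorem maynardFunctional_productTestFn_ge_hoeffdingRatio (n : ℕ) (hg : LocBdd g) (hg0 : ∀ t, 0 ≤ g t)
    (hgT : ∀ x, T < x → g x = 0) (hT0 : 0 ≤ T) (hh : 0 < h) (hJc : T < (Jc : ℝ) * h) (mstar M : ℕ) (δ : ℝ)
    {lam₁ lam₂ : ℝ} (hlam₁ : 0 ≤ lam₁) (hlam₂ : 0 ≤ lam₂) {m₀ : ℝ} (hm₀ : m₀ = ∫ x in Ici 0, g x ^ 2)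
    (hm₀pos : 0 < m₀)
    (hcond₁ : (1 - ((mstar : ℝ) + 1) * h) + lam₁ ≤
      (n + 2 : ℝ) * ((∫ x in Ici 0, roundErr h x * g x ^ 2) / m₀))
    (hcond₂ : δ + lam₂ ≤ (n + 1 : ℝ) * (h - (∫ x in Ici 0, roundErr h x * g x ^ 2) / m₀))
    (hI : 0 < maynardI (n + 2) (productTestFn (n + 2) g)) :
    (n + 2 : ℝ) *
        (∑ m ∈ range M, (∫ u in Ioc 0 (1 - ((((m + (n + 1) : ℕ) : ℝ)) * h - δ)), g u) ^ 2 *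
            dconvPow (cellMass (fun t => g t ^ 2) h) (n + 1) m -
          (∫ u in Ioc 0 T, g u) ^ 2 * (m₀ ^ (n + 1) * Real.exp (-2 * lam₂ ^ 2 / ((n + 1 : ℝ) * h ^ 2)))) /
        (∑ m ∈ range (mstar + 1), dconvPow (cellMass (fun t => g t ^ 2) h) (n + 2) m +
          m₀ ^ (n + 2) * Real.exp (-2 * lam₁ ^ 2 / ((n + 2 : ℝ) * h ^ 2))) ≤
      maynardFunctional (n + 2) (productTestFn (n + 2) g) := by
  have hg2 : LocBdd (fun t => g t ^ 2) := locBdd_sq'' hg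
  have hg20 : ∀ t, 0 ≤ g t ^ 2 := fun t => sq_nonneg _
  have hg2T : ∀ x, T < x → g x ^ 2 = 0 := fun x hx => by rw [hgT x hx]; ring
  rw [maynardFunctional_productTestFn n hg]
  set N := ∫ w in Ioc (0:ℝ) 1, (∫ u in (0:ℝ)..(1 - w), g u) ^ 2 * cpow (fun t => g t ^ 2) (n + 1) w
    with hN
  set D := ∫ w in Ioc (0:ℝ) 1, cpow (fun t => g t ^ 2) (n + 2) w with hD
  -- the weight `Ψ(w) = (∫_{(0,1−w]} g)²`
  set G : ℝ → ℝ := fun y => ∫ u in Ioc 0 y, g u with hGdef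
  set Ψ : ℝ → ℝ := fun w => G (1 - w) ^ 2 with hΨdef
  have hG0 : ∀ y, 0 ≤ G y := fun y => setIntegral_nonneg measurableSet_Ioc fun u _ => hg0 u
  have hGmono : Monotone G := by
    intro a b hab
    exact setIntegral_mono_set (hg.integrableOn_Ioc _ _)
      (Filter.Eventually.of_forall fun u => hg0 u)
      (Filter.Eventually.of_forall (Ioc_subset_Ioc_right hab))
  have hΨ : Antitone Ψ := by
    intro a b hab
    simp only [hΨdef]
    exact pow_le_pow_left₀ (hG0 _) (hGmono (by linarith)) 2
  have hΨ0 : ∀ x, 0 ≤ Ψ x := fun x => sq_nonneg _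
  have hΨ1 : Ψ 1 = 0 := by simp [hΨdef, hGdef]
  have hΨB : ∀ x, Ψ x ≤ (∫ u in Ioc 0 T, g u) ^ 2 := fun x =>
    pow_le_pow_left₀ (hG0 _) (setIntegral_Ioc_le_setIntegral_Ioc_of_support hg hg0 hgT hT0 _) 2
  -- denominator and numerator bounds
  have hDup : D ≤ ∑ m ∈ range (mstar + 1), dconvPow (cellMass (fun t => g t ^ 2) h) (n + 2) m +
      m₀ ^ (n + 2) * Real.exp (-2 * lam₁ ^ 2 / ((n + 2 : ℝ) * h ^ 2)) := by
    have := setIntegral_cpow_le_hoeffding hg2 hg20 hg2T hh hJc (n + 1) mstar hlam₁ hm₀ hm₀pos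
      (by push_cast; linarith)
    push_cast at this
    have e1 : ((n : ℝ) + 1 + 1) = (n : ℝ) + 2 := by ring
    rw [e1] at this
    exact this
  have hNlow : ∑ m ∈ range M, Ψ ((((m + (n + 1) : ℕ) : ℝ)) * h - δ) *
        dconvPow (cellMass (fun t => g t ^ 2) h) (n + 1) m -
      (∫ u in Ioc 0 T, g u) ^ 2 * (m₀ ^ (n + 1) * Real.exp (-2 * lam₂ ^ 2 / ((n + 1 : ℝ) * h ^ 2))) ≤ N := by
    have h1 := sum_weight_dconvPow_le_setIntegral_cpow_hoeffding hg2 hg20 hg2T hh hJc n hΨ hΨ0 hΨB hΨ1 M δ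
      hlam₂ hm₀ hm₀pos hcond₂
    have hR : ∫ w in Ioc 0 1, Ψ w * cpow (fun t => g t ^ 2) (n + 1) w = N := by
      refine setIntegral_congr_fun measurableSet_Ioc fun w hw => ?_
      simp only [hΨdef, hGdef]
      rw [intervalIntegral.integral_of_le (by linarith [hw.2])]
    rw [hR] at h1
    exact h1
  have hDpos : 0 < D := by
    rw [maynardI_productTestFn_eq_cpow (k := n + 2) (by omega) hg] at hI
    exact hI
  have hN0 : 0 ≤ N := by
    rw [hN]
    refine setIntegral_nonneg measurableSet_Ioc fun w _ => mul_nonneg (sq_nonneg _) ?_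
    exact cpow_nonneg hg20 _ _
  have hk0 : (0:ℝ) ≤ n + 2 := by positivity
  set A := ∑ m ∈ range M, (∫ u in Ioc 0 (1 - ((((m + (n + 1) : ℕ) : ℝ)) * h - δ)), g u) ^ 2 *
      dconvPow (cellMass (fun t => g t ^ 2) h) (n + 1) m -
    (∫ u in Ioc 0 T, g u) ^ 2 * (m₀ ^ (n + 1) * Real.exp (-2 * lam₂ ^ 2 / ((n + 1 : ℝ) * h ^ 2))) with hA
  have hAN : A ≤ N := by simpa only [hΨdef, hGdef] using hNlow
  set Dp := ∑ m ∈ range (mstar + 1), dconvPow (cellMass (fun t => g t ^ 2) h) (n + 2) m +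
      m₀ ^ (n + 2) * Real.exp (-2 * lam₁ ^ 2 / ((n + 2 : ℝ) * h ^ 2)) with hDp
  have hDp_pos : 0 < Dp := lt_of_lt_of_le hDpos hDup
  by_cases hA0 : A ≤ 0
  · calc (n + 2 : ℝ) * A / Dp ≤ 0 :=
          div_nonpos_of_nonpos_of_nonneg (mul_nonpos_of_nonneg_of_nonpos hk0 hA0) hDp_pos.le
      _ ≤ (n + 2 : ℝ) * N / D := div_nonneg (mul_nonneg hk0 hN0) hDpos.le
  · have hApos : 0 ≤ A := (not_le.1 hA0).le
    exact div_le_div₀ (mul_nonneg hk0 (hApos.trans hAN)) (mul_le_mul_of_nonneg_left hAN hk0) hDpos hDup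

end HoeffdingRatio

/-! ### Explicit data of Polymath's profile for the recentred certificate -/

section ProfileData

variable {k : ℕ} {c T : ℝ}

/-- On `[0,T]` the squared profile is `1/(c + (k−1)t)²`. [cite: Polymath8b2014, Theorem 6.7 (definition of g)] -/
private theorem polymathProfile_sq_of_mem' {t : ℝ} (ht : t ∈ Icc (0:ℝ) T) :
    polymathProfile k c T t ^ 2 = 1 / (c + ((k:ℝ) - 1) * t) ^ 2 := by
  rw [polymathProfile, Set.indicator_of_mem ht, one_div, one_div, inv_pow]

/-- `∫_a^b dt/(c+(k−1)t)² = (1/(k−1)) (1/(c+(k−1)a) − 1/(c+(k−1)b))` on `[a,b] ⊆ [0,∞)`.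
[cite: Polymath8b2014, Theorem 6.7 (definition of m_2)] -/
private theorem integral_inv_sq_affine' (hk : 2 ≤ k) (hc : 0 < c) {a b : ℝ} (ha : 0 ≤ a) (hab : a ≤ b) :
    ∫ t in a..b, 1 / (c + ((k:ℝ) - 1) * t) ^ 2 =
      1 / ((k:ℝ) - 1) * (1 / (c + ((k:ℝ) - 1) * a) - 1 / (c + ((k:ℝ) - 1) * b)) := by
  have hk1 : (0:ℝ) < (k:ℝ) - 1 := by
    have : (2:ℝ) ≤ k := by exact_mod_cast hk
    linarith
  set κ : ℝ := (k:ℝ) - 1 with hκ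
  have hpos : ∀ t ∈ uIcc a b, 0 < c + κ * t := by
    intro t ht
    rw [uIcc_of_le hab] at ht
    nlinarith [ht.1]
  have hderiv : ∀ t ∈ uIcc a b,
      HasDerivAt (fun t => -(1 / κ) * (c + κ * t)⁻¹) (1 / (c + κ * t) ^ 2) t := by
    intro t ht
    have hne : c + κ * t ≠ 0 := (hpos t ht).ne'
    have h1 : HasDerivAt (fun t => c + κ * t) κ t := by
      simpa using (hasDerivAt_id t).const_mul κ |>.const_add c
    have h2 := (h1.inv hne).const_mul (-(1 / κ))
    refine h2.congr_deriv ?_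
    have hκ0 : κ ≠ 0 := hk1.ne'
    field_simp
  have hcont : ContinuousOn (fun t => 1 / (c + κ * t) ^ 2) (uIcc a b) := by
    refine ContinuousOn.div continuousOn_const ((continuousOn_const.add
      (continuousOn_const.mul continuousOn_id)).pow 2) fun t ht => ?_
    exact pow_ne_zero 2 (hpos t ht).ne'
  rw [intervalIntegral.integral_eq_sub_of_hasDerivAt hderiv (hcont.intervalIntegrable)]
  ring

/-- `m₂ = ∫₀ᵀ g² = ∫_{[0,∞)} g²` for Polymath's profile: the rational number `T/(c(c+(k−1)T))`.
[cite: Polymath8b2014, Theorem 6.7 (definition of m_2)] -/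
theorem setIntegral_Ici_polymathProfile_sq (hk : 2 ≤ k) (hc : 0 < c) (hT : 0 < T) :
    ∫ x in Ici 0, polymathProfile k c T x ^ 2 = T / (c * (c + ((k:ℝ) - 1) * T)) := by
  have hk1 : (0:ℝ) < (k:ℝ) - 1 := by
    have : (2:ℝ) ≤ k := by exact_mod_cast hk
    linarith
  have hg : LocBdd (polymathProfile k c T) := locBdd_polymathProfile (by omega) hc hT.le
  have hvan : ∀ x, x ∉ Ioc 0 T → x ∈ Ici (0:ℝ) → polymathProfile k c T x ^ 2 = 0 ∨ x = 0 := by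
    intro x hx hx0
    by_cases h0 : x = 0
    · exact Or.inr h0
    · left
      have : T < x := by
        by_contra hle
        exact hx ⟨lt_of_le_of_ne hx0 (Ne.symm h0), not_lt.1 hle⟩
      rw [polymathProfile_of_notMem (fun h' => (not_lt.2 h'.2) this)]
      ring
  -- reduce to `(0,T]`, then to the interval integral computed by `integral_inv_sq_affine`
  have h1 : ∫ x in Ici 0, polymathProfile k c T x ^ 2 = ∫ x in Ioc 0 T, polymathProfile k c T x ^ 2 := by
    rw [← integral_indicator measurableSet_Ici, ← integral_indicator measurableSet_Ioc]
    refine integral_congr_ae ?_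
    have hae : ∀ᵐ x : ℝ, x ∈ ({0} : Set ℝ)ᶜ := compl_mem_ae_iff.2 (measure_singleton (0:ℝ))
    filter_upwards [hae] with x hx'
    have hx : x ≠ 0 := fun h0 => hx' (Set.mem_singleton_iff.2 h0)
    by_cases hxs : x ∈ Ioc 0 T
    · rw [indicator_of_mem hxs, indicator_of_mem (show x ∈ Ici (0:ℝ) from hxs.1.le)]
    · rw [indicator_of_notMem hxs]
      by_cases hx0 : x ∈ Ici (0:ℝ)
      · rw [indicator_of_mem hx0]
        rcases hvan x hxs hx0 with h | h
        · exact h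
        · exact absurd h hx
      · rw [indicator_of_notMem hx0]
  rw [h1, ← intervalIntegral.integral_of_le hT.le]
  have h2 : ∫ x in (0:ℝ)..T, polymathProfile k c T x ^ 2 = ∫ x in (0:ℝ)..T, 1 / (c + ((k:ℝ) - 1) * x) ^ 2 := by
    refine intervalIntegral.integral_congr fun t ht => ?_
    rw [uIcc_of_le hT.le] at ht
    exact polymathProfile_sq_of_mem' ht
  rw [h2, integral_inv_sq_affine' hk hc le_rfl hT.le]
  have hcT : 0 < c + ((k:ℝ) - 1) * T := by nlinarith
  field_simp
  ring

/-- The first moment `∫ x g(x)² dx` of Polymath's profile on an interval `[0,b] ⊆ [0,∞)`: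
`∫₀ᵇ x/(c+(k−1)x)² dx = (1/(k−1)²)(log((c+(k−1)b)/c) − (k−1)b/(c+(k−1)b))` (the quantity `m₂ μ` of Theorem 6.7).
[cite: Polymath8b2014, Theorem 6.7 (definition of μ)] -/
theorem integral_id_mul_inv_sq_affine (hk : 2 ≤ k) (hc : 0 < c) {b : ℝ} (hb : 0 ≤ b) :
    ∫ x in (0:ℝ)..b, x / (c + ((k:ℝ) - 1) * x) ^ 2 =
      1 / ((k:ℝ) - 1) ^ 2 * (Real.log ((c + ((k:ℝ) - 1) * b) / c) - ((k:ℝ) - 1) * b / (c + ((k:ℝ) - 1) * b)) := by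
  have hk1 : (0:ℝ) < (k:ℝ) - 1 := by
    have : (2:ℝ) ≤ k := by exact_mod_cast hk
    linarith
  set κ : ℝ := (k:ℝ) - 1 with hκ
  have hκ0 : κ ≠ 0 := hk1.ne'
  have hpos : ∀ x ∈ uIcc (0:ℝ) b, 0 < c + κ * x := by
    intro x hx
    rw [uIcc_of_le hb] at hx
    nlinarith [hx.1]
  -- antiderivative `Φ(x) = (log(c + κ x) + c/(c + κ x))/κ²`
  have hderiv : ∀ x ∈ uIcc (0:ℝ) b,
      HasDerivAt (fun x => 1 / κ ^ 2 * (Real.log (c + κ * x) + c * (c + κ * x)⁻¹)) (x / (c + κ * x) ^ 2) x := by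
    intro x hx
    have hne : c + κ * x ≠ 0 := (hpos x hx).ne'
    have h1 : HasDerivAt (fun x => c + κ * x) κ x := by
      simpa using (hasDerivAt_id x).const_mul κ |>.const_add c
    have h2 := ((h1.log hne).add ((h1.inv hne).const_mul c)).const_mul (1 / κ ^ 2)
    refine h2.congr_deriv ?_
    field_simp
    ring
  have hcont : ContinuousOn (fun x => x / (c + κ * x) ^ 2) (uIcc (0:ℝ) b) := by
    refine ContinuousOn.div continuousOn_id ((continuousOn_const.add
      (continuousOn_const.mul continuousOn_id)).pow 2) fun x hx => pow_ne_zero 2 (hpos x hx).ne'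
  rw [intervalIntegral.integral_eq_sub_of_hasDerivAt hderiv hcont.intervalIntegrable]
  have hcb : c + κ * b ≠ 0 := (hpos b (by rw [uIcc_of_le hb]; exact ⟨hb, le_rfl⟩)).ne'
  rw [mul_zero, add_zero, ← mul_sub, Real.log_div hcb hc.ne']
  field_simp
  ring

/-- `∫_{[0,∞)} x g(x)² dx` for Polymath's profile (`c, T > 0`, `k ≥ 2`).
[cite: Polymath8b2014, Theorem 6.7 (definition of μ)] -/
theorem setIntegral_Ici_id_mul_polymathProfile_sq (hk : 2 ≤ k) (hc : 0 < c) (hT : 0 < T) :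
    ∫ x in Ici 0, x * polymathProfile k c T x ^ 2 =
      1 / ((k:ℝ) - 1) ^ 2 *
        (Real.log ((c + ((k:ℝ) - 1) * T) / c) - ((k:ℝ) - 1) * T / (c + ((k:ℝ) - 1) * T)) := by
  have hg : LocBdd (polymathProfile k c T) := locBdd_polymathProfile (by omega) hc hT.le
  have hF : LocBdd (fun x => x * polymathProfile k c T x ^ 2) := by
    have : (fun x => x * polymathProfile k c T x ^ 2) = fun x => x * (polymathProfile k c T x * polymathProfile k c T x) := by
      funext x; ring
    rw [this]
    exact (hg.mul hg).id_mul
  -- reduce to `(0,T]`: the integrand vanishes at `0` and beyond `T`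
  have h1 : ∫ x in Ici 0, x * polymathProfile k c T x ^ 2 = ∫ x in Ioc 0 T, x * polymathProfile k c T x ^ 2 := by
    rw [← integral_indicator measurableSet_Ici, ← integral_indicator measurableSet_Ioc]
    congr 1; funext x
    by_cases hxs : x ∈ Ioc 0 T
    · rw [indicator_of_mem hxs, indicator_of_mem (show x ∈ Ici (0:ℝ) from hxs.1.le)]
    · rw [indicator_of_notMem hxs]
      by_cases hx0 : x ∈ Ici (0:ℝ)
      · rw [indicator_of_mem hx0]
        by_cases h0 : x = 0
        · rw [h0, zero_mul]
        · have : T < x := by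
            by_contra hle
            exact hxs ⟨lt_of_le_of_ne hx0 (Ne.symm h0), not_lt.1 hle⟩
          rw [polymathProfile_of_notMem (fun h' => (not_lt.2 h'.2) this)]
          ring
      · rw [indicator_of_notMem hx0]
  rw [h1, ← intervalIntegral.integral_of_le hT.le]
  have h2 : ∫ x in (0:ℝ)..T, x * polymathProfile k c T x ^ 2 = ∫ x in (0:ℝ)..T, x / (c + ((k:ℝ) - 1) * x) ^ 2 := by
    refine intervalIntegral.integral_congr fun t ht => ?_
    rw [uIcc_of_le hT.le] at ht
    rw [polymathProfile_sq_of_mem' ht, mul_one_div]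
  rw [h2, integral_id_mul_inv_sq_affine hk hc hT.le]

/-- **The first rounding moment splits off the lattice part**: for `φ` locally bounded vanishing beyond `T < J_c h`,
`∫_{[0,∞)} r_h φ = ∫_{[0,∞)} x φ(x) dx − h Σ_{j<J_c} j p_j`. [cite: KlugmanPanjerWillmot2004, §6.6.5.1 (method of rounding)] -/
theorem setIntegral_roundErr_mul_eq {φ : ℝ → ℝ} {h : ℝ} {Jc : ℕ} (hφ : LocBdd φ) (hT : ∀ x, T < x → φ x = 0)
    (hh : 0 < h) (hJc : T < (Jc : ℝ) * h) :
    ∫ x in Ici 0, roundErr h x * φ x =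
      (∫ x in Ici 0, x * φ x) - h * ∑ j ∈ range Jc, (j : ℝ) * cellMass φ h j := by
  -- `r_h φ₊ = x φ₊ − h ⌊x/h⌋ φ₊`, and `⌊x/h⌋ φ₊ = Σ_j j 𝟙_{C_j} φ`
  have hdec : ∀ x, roundErr h x * posPart' φ x =
      x * posPart' φ x - h * ∑ j ∈ range Jc, (j : ℝ) * cellFn φ h j x := by
    intro x
    rw [roundErr, sub_mul, Finset.mul_sum]
    congr 1
    rw [posPart'_eq_sum_cellFn hh hT hJc x]
    simp only [Finset.mul_sum]
    refine Finset.sum_congr rfl fun j _ => ?_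
    by_cases hx : x ∈ Ico ((j : ℝ) * h) (((j : ℝ) + 1) * h)
    · rw [(mem_Ico_iff_floor hh).1 hx]; push_cast; ring
    · rw [cellFn, indicator_of_notMem hx]; ring
  have hint_eq : ∀ g : ℝ → ℝ, ∫ x in Ici 0, g x * φ x = ∫ x, g x * posPart' φ x := by
    intro g
    rw [← integral_indicator measurableSet_Ici]
    congr 1; funext x
    simp only [posPart', Set.indicator]
    split_ifs <;> simp
  rw [hint_eq, hint_eq (fun x => x)]
  simp_rw [hdec]
  have hint1 : Integrable fun x => x * posPart' φ x := by
    have h1 : (fun x => x * posPart' φ x) = (Ici (0:ℝ)).indicator (fun x => x * φ x) := by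
      funext x; simp only [posPart', Set.indicator]; split_ifs <;> simp
    rw [h1, integrable_indicator_iff measurableSet_Ici]
    -- supported in `[0, T]`: integrable there, zero beyond
    have hloc : LocBdd (fun x => x * φ x) := hφ.id_mul
    have h2 : IntegrableOn (fun x => x * φ x) (Icc 0 (max T 0)) := by
      rw [integrableOn_Icc_iff_integrableOn_Ioc]; exact hloc.integrableOn_Ioc _ _
    have h3 : IntegrableOn (fun x => x * φ x) (Ioi (max T 0)) := by
      refine (integrableOn_congr_fun (fun x hx => ?_) measurableSet_Ioi).1 (integrableOn_zero)
      show (0:ℝ) = x * φ x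
      rw [hT x (lt_of_le_of_lt (le_max_left _ _) hx), mul_zero]
    have h4 : Ici (0:ℝ) ⊆ Icc 0 (max T 0) ∪ Ioi (max T 0) := by
      intro x hx
      by_cases hxT : x ≤ max T 0
      · exact Or.inl ⟨hx, hxT⟩
      · exact Or.inr (not_le.1 hxT)
    exact (h2.union h3).mono_set h4
  have hint2 : ∀ j ∈ range Jc, Integrable fun x => (j : ℝ) * cellFn φ h j x :=
    fun j _ => (integrable_cellFn hφ h j).const_mul _
  rw [integral_sub hint1 ((integrable_finsetSum _ hint2).const_mul h), integral_const_mul,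
    integral_finsetSum _ hint2]
  congr 2
  refine Finset.sum_congr rfl fun j _ => ?_
  rw [integral_const_mul, integral_cellFn]

end ProfileData

/-! ### The checker-facing inequality for Polymath's product family (Hoeffding-recentred) -/

section ProfileHoeffding

/-- **Kernel-certificate shape of `M_k ≥ …`, Hoeffding-recentred.**  For `k = n+2`, `c, T, h > 0`, `T < J_c h`, with
`g = 1_{[0,T]}/(c+(k−1)t)`, `p_j = ∫_{(jh,(j+1)h]} g²` (rationals, `cellMass_polymathProfile_sq`), the explicit mass
`m₂ = T/(c(c+(k−1)T))`, first moment `μ₁ = (log((c+(k−1)T)/c) − (k−1)T/(c+(k−1)T))/(k−1)²` and first rounding moment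
`E₁ = μ₁ − h Σ_{j<J_c} j p_j`, parameters `m⋆, M, δ, λ₁, λ₂ ≥ 0` with `1 − (m⋆+1)h + λ₁ ≤ k E₁/m₂` and
`δ + λ₂ ≤ (k−1)(h − E₁/m₂)`:
`k (Σ_{m<M} (∫_{(0,1−((m+k−1)h−δ)]} g)² (p^{∗(k−1)})_m − (∫_{(0,T]} g)² m₂^{k−1} e^{−2λ₂²/((k−1)h²)}) / (Σ_{m≤m⋆}(p^{∗k})_m + m₂^k e^{−2λ₁²/(kh²)})
≤ (Σ J^{(m)}(F))/I(F)` (the `∫_{(0,x]} g` are `(1/(k−1)) log((c+(k−1)min(x⁺,T))/c)`, `setIntegral_Ioc_polymathProfile`). The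
proof-of-Theorem-6.7 ratio with outward lattice discretisation and Hoeffding recentring. [cite: Polymath8b2014, §6, proof of Theorem 6.7 (I(F), J_k(F))] -/
theorem maynardFunctional_polymathProfile_ge_hoeffdingRatio (n : ℕ) {c T h : ℝ} (hc : 0 < c) (hT : 0 < T)
    (hh : 0 < h) {Jc : ℕ} (hJc : T < (Jc : ℝ) * h) (mstar M : ℕ) (δ : ℝ) {lam₁ lam₂ : ℝ}
    (hlam₁ : 0 ≤ lam₁) (hlam₂ : 0 ≤ lam₂)
    (hcond₁ : (1 - ((mstar : ℝ) + 1) * h) + lam₁ ≤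
      (n + 2 : ℝ) * ((1 / ((n : ℝ) + 1) ^ 2 * (Real.log ((c + ((n : ℝ) + 1) * T) / c) -
            ((n : ℝ) + 1) * T / (c + ((n : ℝ) + 1) * T)) -
          h * ∑ j ∈ range Jc, (j : ℝ) * cellMass (fun t => polymathProfile (n + 2) c T t ^ 2) h j) /
        (T / (c * (c + ((n : ℝ) + 1) * T)))))
    (hcond₂ : δ + lam₂ ≤
      (n + 1 : ℝ) * (h - ((1 / ((n : ℝ) + 1) ^ 2 * (Real.log ((c + ((n : ℝ) + 1) * T) / c) -
            ((n : ℝ) + 1) * T / (c + ((n : ℝ) + 1) * T)) -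
          h * ∑ j ∈ range Jc, (j : ℝ) * cellMass (fun t => polymathProfile (n + 2) c T t ^ 2) h j) /
        (T / (c * (c + ((n : ℝ) + 1) * T)))))) :
    (n + 2 : ℝ) *
        (∑ m ∈ range M, (∫ u in Ioc 0 (1 - ((((m + (n + 1) : ℕ) : ℝ)) * h - δ)), polymathProfile (n + 2) c T u) ^ 2 *
            dconvPow (cellMass (fun t => polymathProfile (n + 2) c T t ^ 2) h) (n + 1) m -
          (∫ u in Ioc 0 T, polymathProfile (n + 2) c T u) ^ 2 *
            ((T / (c * (c + ((n : ℝ) + 1) * T))) ^ (n + 1) * Real.exp (-2 * lam₂ ^ 2 / ((n + 1 : ℝ) * h ^ 2)))) /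
        (∑ m ∈ range (mstar + 1), dconvPow (cellMass (fun t => polymathProfile (n + 2) c T t ^ 2) h) (n + 2) m +
          (T / (c * (c + ((n : ℝ) + 1) * T))) ^ (n + 2) * Real.exp (-2 * lam₁ ^ 2 / ((n + 2 : ℝ) * h ^ 2))) ≤
      maynardFunctional (n + 2) (productTestFn (n + 2) (polymathProfile (n + 2) c T)) := by
  have hk : (((n + 2 : ℕ) : ℝ) - 1) = (n : ℝ) + 1 := by push_cast; ring
  have hg : LocBdd (polymathProfile (n + 2) c T) := locBdd_polymathProfile (by omega) hc hT.le
  have hg0 : ∀ t, 0 ≤ polymathProfile (n + 2) c T t := by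
    intro t
    by_cases ht : t ∈ Icc (0:ℝ) T
    · have h1 := (polymathProfile_mem_Icc (k := n + 2) (by omega) hc hT.le ht).1
      refine le_trans (one_div_pos.2 ?_).le h1
      have : (0:ℝ) ≤ ((n + 2 : ℕ) : ℝ) - 1 := by push_cast; linarith
      nlinarith [ht.2, hT]
    · rw [polymathProfile_of_notMem ht]
  have hgT : ∀ x, T < x → polymathProfile (n + 2) c T x = 0 := fun x hx =>
    polymathProfile_of_notMem fun h' => (not_lt.2 h'.2) hx
  have hI := (isMaynardAdmissible_productTestFn_polymathProfile (k := n + 2) (by omega) hc hT).maynardI_pos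
  -- the explicit mass and first rounding moment
  have hm₂ : T / (c * (c + ((n : ℝ) + 1) * T)) = ∫ x in Ici 0, polymathProfile (n + 2) c T x ^ 2 := by
    rw [setIntegral_Ici_polymathProfile_sq (k := n + 2) (by omega) hc hT, hk]
  have hm₂pos : 0 < T / (c * (c + ((n : ℝ) + 1) * T)) := by positivity
  have hE : ∫ x in Ici 0, roundErr h x * polymathProfile (n + 2) c T x ^ 2 =
      (1 / ((n : ℝ) + 1) ^ 2 * (Real.log ((c + ((n : ℝ) + 1) * T) / c) -
          ((n : ℝ) + 1) * T / (c + ((n : ℝ) + 1) * T)) -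
        h * ∑ j ∈ range Jc, (j : ℝ) * cellMass (fun t => polymathProfile (n + 2) c T t ^ 2) h j) := by
    have hg2 : LocBdd (fun t => polymathProfile (n + 2) c T t ^ 2) := locBdd_sq'' hg
    have hg2T : ∀ x, T < x → polymathProfile (n + 2) c T x ^ 2 = 0 := fun x hx => by rw [hgT x hx]; ring
    rw [setIntegral_roundErr_mul_eq hg2 hg2T hh hJc, setIntegral_Ici_id_mul_polymathProfile_sq (k := n + 2)
      (by omega) hc hT, hk]
  rw [← hE] at hcond₁ hcond₂
  exact maynardFunctional_productTestFn_ge_hoeffdingRatio n hg hg0 hgT hT.le hh hJc mstar M δ hlam₁ hlam₂ hm₂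
    hm₂pos hcond₁ hcond₂ hI

end ProfileHoeffding

end MaynardTao

end Literature.NumberTheory.Sieve
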